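import Literature.AlgebraicGeometry.Frobenioids.ArchimedeanProp35iSaturationIff
import Literature.AlgebraicGeometry.Frobenioids.ArchimedeanPointBase
import HarnessLib

/-!
# Frobenioids II, Proposition 3.5 (i) AS TYPED over the bases that occur: faithful base functors and
# purely complex bases (in particular the one-morphism base at `Spec ℂ` of [IUTchI] Example 3.4)

Mochizuki, *The geometry of Frobenioids II: poly-Frobenioids*, Kyushu J. Math. **62** (2008) 401–460,
§3, Proposition 3.5 (i), kurims p. 34 [cite: MochizukiFrdII2008, Prop 3.5 (i) p.34].

PROOF-ONLY file (abc-iut-w4-d100, gen 2). By `ArchimedeanProp35iSaturationIff.lean` the typed instances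
`Prop35i_C/_A/_N` of [FrdII] Prop. 3.5 (i) over a base `π : D → D₀` hold iff every mono-minimal quotient
datum under an object of `C` is Galois-saturated for `π` (finding P35i-F1: over the Galois-COLLAPSING base
they fail). This file records that the condition holds over every base that actually occurs:
* `galoisSaturated_of_faithful` — if `π` is FAITHFUL, every categorical quotient datum `(B_D → A_D, G_D)`
  is Galois-saturated: were `π(G_D)` trivial on `Spec ℂ = π B_D` over a real `π A_D`, faithfulness gives
  `G_D = 1`, so `B_D → A_D` would be a categorical quotient by the trivial group, i.e. split by an arrow
  `A_D → B_D` — impossible over `Spec ℝ ← Spec ℂ` (there is no arrow `Spec ℝ → Spec ℂ` in `D₀`);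
* `galoisSaturated_of_forall_isComplex` — if every object of `D` is complex (no real objects), saturation
  is void;
* hence **`prop35i_all_of_faithful`** and **`prop35i_all_of_forall_isComplex`**: all four typed instances
  `Prop35i_C π ∧ Prop35i_A π ∧ Prop35i_N π ∧ Prop35i_R π` hold AS TYPED over such bases; in particular
  **`prop35i_all_ptBase`** for THE base of [IUTchI] Example 3.4 (i) — the one-morphism category at
  `Spec K_v = Spec ℂ` (`ArchFrd.ptBase`, abc-iut-L1-t6; `F ∋ √−1`, so every archimedean place of the
  number fields of [IUTchI] Def. 3.1 is complex).
So the FACT-LIST rows F-0857/F-0858/F-0859 (`Prop35i_A/_C/_N`, universal closure refuted) are available BY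
THEOREM at every faithful or purely complex base, and F-0860 (`Prop35i_R`) at every base. Nothing here bears
on [IUTchIII] Cor. 3.12; typed ≠ proved except where a `theorem` says so.
-/

namespace Literature.AlgebraicGeometry.Frobenioids

open CategoryTheory

noncomputable section

namespace ArchFrd

universe v u

variable {D : Type u} [Category.{v} D] (π : D ⥤ D0)

/-- **A categorical quotient datum over a FAITHFUL base functor is Galois-saturated.**
[cite: MochizukiFrdII2008, Prop 3.5 (i) p.34] -/
theorem galoisSaturated_of_faithful [π.Faithful] {BD AD : D} (fD : BD ⟶ AD) (GD : Subgroup (Aut BD))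
    (hq : IsCategoricalQuotient GD fD) : GaloisSaturated π fD GD := by
  by_contra hns
  obtain ⟨hBc, hAr, hkill⟩ := of_not_galoisSaturated π fD GD hns
  -- `π` kills `G_D` and is faithful: `G_D` is trivial, so every arrow out of `B_D` factors through `f_D`
  obtain ⟨r, hr, -⟩ := hq.2 (𝟙 BD) (fun g hg => by
    have h1 : g.hom = 𝟙 BD := π.map_injective (by rw [hkill g hg, π.map_id])
    rw [h1, Category.id_comp])
  -- … in particular the identity: `f_D ≫ r = 𝟙`, and `π r : Spec ℝ-object → Spec ℂ-object` cannot exist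
  have hreal : (π.obj BD).IsReal := UnitStab.D0.isReal_of_hom_real (π.map r) hAr
  unfold D0.IsReal at hreal
  unfold D0.IsComplex at hBc
  exact absurd (hreal.symm.trans hBc) (by decide)

/-- **Over a base without real objects, every quotient datum is Galois-saturated** (the condition is void).
[cite: MochizukiFrdII2008, Prop 3.5 (i) p.34] -/
theorem galoisSaturated_of_forall_isComplex (hc : ∀ d : D, (π.obj d).IsComplex) {BD AD : D}
    (fD : BD ⟶ AD) (GD : Subgroup (Aut BD)) : GaloisSaturated π fD GD :=
  galoisSaturated_of_isComplex π fD GD (hc AD)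

/-- **[FrdII] Prop. 3.5 (i) AS TYPED, all four instances, over a FAITHFUL base functor.**
[cite: MochizukiFrdII2008, Prop 3.5 (i) p.34] -/
theorem prop35i_all_of_faithful [π.Faithful] :
    Prop35i_C π ∧ Prop35i_A π ∧ Prop35i_N π ∧ Prop35i_R π :=
  prop35i_all_of_saturated π fun _ _ fD GD hq => galoisSaturated_of_faithful π fD GD hq.1

/-- **[FrdII] Prop. 3.5 (i) AS TYPED, all four instances, over a base all of whose objects are complex.**
[cite: MochizukiFrdII2008, Prop 3.5 (i) p.34] -/
theorem prop35i_all_of_forall_isComplex (hc : ∀ d : D, (π.obj d).IsComplex) :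
    Prop35i_C π ∧ Prop35i_A π ∧ Prop35i_N π ∧ Prop35i_R π :=
  prop35i_all_of_saturated π fun _ _ fD GD _ => galoisSaturated_of_forall_isComplex π hc fD GD

/-- **[FrdII] Prop. 3.5 (i) AS TYPED over THE base of [IUTchI] Example 3.4 (i)**: the one-morphism base at
`Spec ℂ` (`ArchFrd.ptBase`), for `C = Cpt`, `A`, `N`, `R` over it. [cite: MochizukiFrdII2008, Prop 3.5 (i) p.34] -/
theorem prop35i_all_ptBase :
    Prop35i_C ptBase ∧ Prop35i_A ptBase ∧ Prop35i_N ptBase ∧ Prop35i_R ptBase :=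
  prop35i_all_of_forall_isComplex ptBase fun _ => rfl

end ArchFrd

end

end Literature.AlgebraicGeometry.Frobenioids
-- re-land 2026-08-26T07:5xZ (abc-iut-w4-d027 g4; author of record abc-iut-w4-d100 g2, p420323): content byte-identical, comment-only append to re-dispatch the olean build (module ACCEPTED 03:46Z, farm `unbuilt` at 07:33Z; body elaborates rc 0 against its built parents).
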